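import Mathlib.Analysis.Fourier.AddCircle
import Mathlib.Algebra.Order.Chebyshev
import HarnessLib

/-!
# Bernstein's theorem on `ℝ/ℤ`: Lipschitz functions have absolutely summable Fourier series

Topic `Literature/Analysis/Fourier`. Y. Katznelson, *An Introduction to Harmonic Analysis* (3rd
ed., CUP 2004), Ch. I, §6.3, Theorem (Bernstein): a function in `Lip_α(𝕋)`, `α > 1/2`, has an
absolutely convergent Fourier series, with `‖f‖_{A(𝕋)} ≤ c_α ‖f‖_{Lip_α}`. This file proves the case
`α = 1` on `AddCircle 1 = ℝ/ℤ` in quantitative form, by the printed dyadic argument, and draws the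
consequence used in `Literature/NumberTheory/Sieve` (Green–Tao 2010, Cor. 11.6 and Prop. 10.2 at
`s = 1`, where Lipschitz nilsequences on the circle are replaced by trigonometric polynomials):

* `Literature.Analysis.Fourier.fourierCoeff_comp_add_right`, `fourierCoeff_translateSub` — Fourier
  coefficients of translates, `(F(·+h) - F)^(m) = (e_m(h) - 1) F̂(m)`;
* `Literature.Analysis.Fourier.hasSum_sq_fourierCoeff_translateSub` — Parseval for `F(·+h) - F`
  (Mathlib's `hasSum_sq_fourierCoeff` on `ContinuousMap.toLp`), and the Lipschitz bound
  `∫|F(x+h) - F(x)|² ≤ (M‖h‖)²` (`integral_sq_translateSub_le`) — display (6.4);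
* `Literature.Analysis.Fourier.sum_dyadicBlock_sq_le`, `sum_dyadicBlock_le` — the dyadic block
  estimates (6.4)–(6.5) with `h = 1/(4L)` (`|e_m(h) - 1|² ≥ 2` for `L ≤ |m| < 2L`):
  `∑_{L ≤ |m| < 2L} |F̂(m)| ≤ M/(4√L)`;
* `Literature.Analysis.Fourier.sum_quadTail_le'` — summed over the blocks:
  `∑_{K ≤ |m| < 4^J K} |F̂(m)| ≤ M/√K`; `Literature.Analysis.Fourier.summable_norm_fourierCoeff` —
  **Bernstein's theorem** (absolute summability) for `M`-Lipschitz `F`;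
* `Literature.Analysis.Fourier.norm_sub_trigPoly_le` — the **uniform approximation by the Fourier
  partial sums**: `|F(x) - ∑_{|m| < K} F̂(m) e_m(x)| ≤ M/√K` for all `x` (via Mathlib's
  `has_pointwise_sum_fourier_series_of_summable`), with `|F̂(m)| ≤ 1`
  (`norm_fourierCoeff_le_one`).

Everything is proved; functions are `C(AddCircle (1:ℝ), ℂ)` with the Lipschitz hypothesis
`‖F x - F y‖ ≤ M dist x y` and `‖F‖_∞ ≤ 1`.

## References

* Y. Katznelson, *An Introduction to Harmonic Analysis*, 3rd ed., Cambridge Univ. Press (2004),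
  Ch. I, §6.2 (Theorem: `f' ∈ L²` ⇒ `f ∈ A(𝕋)`), §6.3 (Bernstein's theorem and its proof,
  (6.3)–(6.5)). [cite: Katznelson2004, Ch. I, §6.3]
* S. N. Bernstein, *Sur la convergence absolue des séries trigonométriques*, C. R. Acad. Sci.
  Paris 158 (1914), 1661–1663 (the original). [folklore]
-/

noncomputable section

open MeasureTheory Complex Finset AddCircle
open scoped BigOperators Real

namespace Literature.Analysis.Fourier

section translate

variable (F : C(AddCircle (1 : ℝ), ℂ))

/-- Continuous functions on the circle are integrable for the Haar probability measure. [folklore] -/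
theorem integrable_continuousMap (G : C(AddCircle (1 : ℝ), ℂ)) : Integrable G haarAddCircle :=
  G.continuous.integrable_of_hasCompactSupport (HasCompactSupport.of_compactSpace G)

/-- The characters are multiplicative in the space variable: `e_n(x + y) = e_n(x) e_n(y)`. [folklore] -/
theorem fourier_apply_add (n : ℤ) (x y : AddCircle (1 : ℝ)) :
    fourier n (x + y) = fourier n x * fourier n y := by
  rw [fourier_apply, fourier_apply, fourier_apply, smul_add, toCircle_add, Circle.coe_mul]

/-- `e_{-n}(-y) = e_n(y)`. [folklore] -/
theorem fourier_neg_apply_neg (n : ℤ) (y : AddCircle (1 : ℝ)) : fourier (-n) (-y) = fourier n y := by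
  rw [fourier_apply, fourier_apply, neg_smul_neg]

/-- **Fourier coefficients of a translate**: `(F(· + h))^(m) = e_m(h) F̂(m)`.
[cite: Katznelson2004, Ch. I, §1.4 (elementary properties) and §6.3 (proof of Bernstein's theorem)] -/
theorem fourierCoeff_comp_add_right (h : AddCircle (1 : ℝ)) (m : ℤ) :
    fourierCoeff (fun x => F (x + h)) m = fourier m h * fourierCoeff F m := by
  unfold fourierCoeff
  have hshift := integral_add_right_eq_self (μ := (haarAddCircle : Measure (AddCircle (1 : ℝ))))
    (fun y => fourier (-m) (y - h) • F y) h
  simp only [add_sub_cancel_right] at hshift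
  rw [hshift]
  have h2 : ∀ y : AddCircle (1 : ℝ), fourier (-m) (y - h) = fourier m h * fourier (-m) y := by
    intro y
    rw [sub_eq_add_neg, fourier_apply_add, fourier_neg_apply_neg, mul_comm]
  simp_rw [h2, mul_smul]
  rw [integral_smul, smul_eq_mul]

/-- The difference `G_h = F(· + h) - F` as a continuous map. [folklore] -/
def translateSub (h : AddCircle (1 : ℝ)) : C(AddCircle (1 : ℝ), ℂ) where
  toFun x := F (x + h) - F x
  continuous_toFun := (F.continuous.comp (continuous_id.add continuous_const)).sub F.continuous

/-- `translateSub F h x = F(x + h) - F(x)`. [folklore] -/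
@[simp] theorem translateSub_apply (h x : AddCircle (1 : ℝ)) : translateSub F h x = F (x + h) - F x := rfl

/-- `Ĝ_h(m) = (e_m(h) - 1) F̂(m)`. [cite: Katznelson2004, Ch. I, §6.3 (first display of the proof of
Bernstein's theorem)] -/
theorem fourierCoeff_translateSub (h : AddCircle (1 : ℝ)) (m : ℤ) :
    fourierCoeff (translateSub F h) m = (fourier m h - 1) * fourierCoeff F m := by
  have hint1 : Integrable (fun x => F (x + h)) haarAddCircle :=
    integrable_continuousMap (F.comp ⟨fun x => x + h, continuous_id.add continuous_const⟩)
  have hint2 : Integrable (fun x => -F x) haarAddCircle := (integrable_continuousMap F).neg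
  have hsum : (translateSub F h : AddCircle (1 : ℝ) → ℂ) = (fun x => F (x + h)) + fun x => -F x := by
    funext x; simp [sub_eq_add_neg]
  rw [hsum, fourierCoeff.add hint1 hint2, Pi.add_apply, fourierCoeff_comp_add_right]
  have hneg : fourierCoeff (fun x => -F x) m = -fourierCoeff F m := by
    unfold fourierCoeff
    simp_rw [smul_neg]
    rw [integral_neg]
  rw [hneg]
  ring

/-- **Parseval for the difference `G_h`**:
`∑_m |e_m(h) - 1|² |F̂(m)|² = ∫ |F(x + h) - F(x)|² dx`.
[cite: Katznelson2004, Ch. I, §6.3, (6.4) (the identity `∑ |e^{-inh} - 1|²|f̂(n)|² = ‖f_h - f‖²_{L²}`)] -/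
theorem hasSum_sq_fourierCoeff_translateSub (h : AddCircle (1 : ℝ)) :
    HasSum (fun m : ℤ => ‖fourier m h - 1‖ ^ 2 * ‖fourierCoeff F m‖ ^ 2)
      (∫ x, ‖F (x + h) - F x‖ ^ 2 ∂haarAddCircle) := by
  have hP := hasSum_sq_fourierCoeff (ContinuousMap.toLp (E := ℂ) 2 haarAddCircle ℂ (translateSub F h))
  have hcoef : ∀ m : ℤ, fourierCoeff (ContinuousMap.toLp (E := ℂ) 2 haarAddCircle ℂ (translateSub F h)) m =
      (fourier m h - 1) * fourierCoeff F m := fun m => by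
    rw [fourierCoeff_toLp, fourierCoeff_translateSub]
  simp_rw [hcoef, norm_mul, mul_pow] at hP
  have hint : (∫ t, ‖(ContinuousMap.toLp (E := ℂ) 2 haarAddCircle ℂ (translateSub F h) : AddCircle (1 : ℝ) → ℂ) t‖ ^ 2
      ∂haarAddCircle) = ∫ x, ‖F (x + h) - F x‖ ^ 2 ∂haarAddCircle := by
    refine integral_congr_ae ?_
    filter_upwards [ContinuousMap.coeFn_toLp (E := ℂ) (p := 2) haarAddCircle (𝕜 := ℂ) (translateSub F h)]
      with t ht
    rw [ht, translateSub_apply]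
  rwa [hint] at hP

end translate

section bernstein

variable (F : C(AddCircle (1 : ℝ), ℂ)) {M : ℝ}

/-- The Lipschitz bound on the `L²` norm of the difference:
`∫ |F(x+h) - F(x)|² ≤ (M ‖h‖)²`. [cite: Katznelson2004, Ch. I, §6.3, (6.4)] -/
theorem integral_sq_translateSub_le (hF : ∀ x y, ‖F x - F y‖ ≤ M * dist x y) (h : AddCircle (1 : ℝ)) :
    (∫ x, ‖F (x + h) - F x‖ ^ 2 ∂haarAddCircle) ≤ (M * ‖h‖) ^ 2 := by
  have hpt : ∀ x : AddCircle (1 : ℝ), ‖F (x + h) - F x‖ ^ 2 ≤ (M * ‖h‖) ^ 2 := by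
    intro x
    have h1 : ‖F (x + h) - F x‖ ≤ M * ‖h‖ := by
      have := hF (x + h) x
      rwa [dist_eq_norm, add_sub_cancel_left] at this
    exact pow_le_pow_left₀ (norm_nonneg _) h1 2
  calc (∫ x, ‖F (x + h) - F x‖ ^ 2 ∂haarAddCircle)
      ≤ ∫ _x, (M * ‖h‖) ^ 2 ∂(haarAddCircle : Measure (AddCircle (1 : ℝ))) := by
        refine integral_mono_of_nonneg (Filter.Eventually.of_forall fun x => by positivity)
          (integrable_const _) (Filter.Eventually.of_forall hpt)
    _ = (M * ‖h‖) ^ 2 := by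
        rw [integral_const, smul_eq_mul]
        simp

/-- `|F̂(m)| ≤ 1` for `|F| ≤ 1`. [folklore] -/
theorem norm_fourierCoeff_le_one (hF1 : ∀ x, ‖F x‖ ≤ 1) (m : ℤ) : ‖fourierCoeff F m‖ ≤ 1 := by
  unfold fourierCoeff
  refine (norm_integral_le_integral_norm _).trans ?_
  calc (∫ x, ‖fourier (-m) x • F x‖ ∂(haarAddCircle : Measure (AddCircle (1 : ℝ))))
      ≤ ∫ _x, (1 : ℝ) ∂(haarAddCircle : Measure (AddCircle (1 : ℝ))) := by
        refine integral_mono_of_nonneg (Filter.Eventually.of_forall fun x => norm_nonneg _)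
          (integrable_const _) (Filter.Eventually.of_forall fun x => ?_)
        show ‖fourier (-m) x • F x‖ ≤ 1
        rw [norm_smul, fourier_apply, Circle.norm_coe, one_mul]
        exact hF1 x
    _ = 1 := by rw [integral_const, smul_eq_mul]; simp

/-- The step `h = 1/(4L)` of the dyadic argument, as a point of the circle. [cite: Katznelson2004,
Ch. I, §6.3 (the choice `h = (2π/3)2^{-m}`)] -/
def dyadicStep (L : ℕ) : AddCircle (1 : ℝ) := (((1 : ℝ) / (4 * L)) : ℝ)

/-- `‖1/(4L)‖_{ℝ/ℤ} = 1/(4L)` for `L ≥ 1`. [folklore] -/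
theorem norm_dyadicStep {L : ℕ} (hL : 1 ≤ L) : ‖dyadicStep L‖ = 1 / (4 * L) := by
  have hLpos : (0 : ℝ) < L := by exact_mod_cast hL
  have hL1 : (1 : ℝ) ≤ L := by exact_mod_cast hL
  unfold dyadicStep
  rw [(AddCircle.norm_coe_eq_abs_iff (1 : ℝ) one_ne_zero).mpr, abs_of_pos (by positivity)]
  rw [abs_of_pos (by positivity), abs_one]
  rw [div_le_div_iff₀ (by positivity) (by norm_num)]
  nlinarith

/-- On the dyadic block `L ≤ |m| < 2L`, `|e_m(1/4L) - 1|² ≥ 2` (the angle `πm/2L` lies in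
`[π/2, π)` up to sign, where `cos ≤ 0`). [cite: Katznelson2004, Ch. I, §6.3 ("`|e^{-inh} - 1| ≥ √3`")] -/
theorem two_le_norm_fourier_dyadicStep_sub_one_sq {L : ℕ} (hL : 1 ≤ L) {m : ℤ} (hm1 : (L : ℤ) ≤ |m|)
    (hm2 : |m| < 2 * L) : 2 ≤ ‖fourier m (dyadicStep L) - 1‖ ^ 2 := by
  have hLpos : (0 : ℝ) < L := by exact_mod_cast hL
  set θ : ℝ := Real.pi * m / (2 * L) with hθ
  have hfour : fourier m (dyadicStep L) = Complex.exp (θ * Complex.I) := by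
    unfold dyadicStep
    rw [fourier_coe_apply]
    congr 1
    rw [hθ]
    push_cast
    field_simp
    ring
  have hnorm : ‖Complex.exp (θ * Complex.I) - 1‖ ^ 2 = 2 - 2 * Real.cos θ := by
    rw [Complex.sq_norm, Complex.normSq_apply]
    simp only [Complex.sub_re, Complex.sub_im, Complex.exp_ofReal_mul_I_re, Complex.exp_ofReal_mul_I_im,
      Complex.one_re, Complex.one_im, sub_zero]
    nlinarith [Real.sin_sq_add_cos_sq θ]
  rw [hfour, hnorm]
  -- `cos θ ≤ 0` since `π/2 ≤ |θ| ≤ π`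
  suffices hcos : Real.cos θ ≤ 0 by linarith
  have habs : Real.pi / 2 ≤ |θ| ∧ |θ| ≤ Real.pi := by
    rw [hθ, abs_div, abs_mul, abs_of_pos Real.pi_pos, abs_of_pos (by positivity : (0 : ℝ) < 2 * L)]
    have h1 : (L : ℝ) ≤ |(m : ℝ)| := by rw [← Int.cast_abs]; exact_mod_cast hm1
    have h2 : |(m : ℝ)| ≤ 2 * L := by rw [← Int.cast_abs]; exact_mod_cast hm2.le
    constructor
    · rw [le_div_iff₀ (by positivity)]; nlinarith [Real.pi_pos]
    · rw [div_le_iff₀ (by positivity)]; nlinarith [Real.pi_pos]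
  rw [← Real.cos_abs]
  exact Real.cos_nonpos_of_pi_div_two_le_of_le habs.1 (by linarith [Real.pi_pos])

/-- The dyadic block `{m : L ≤ |m| < 2L}`. [cite: Katznelson2004, Ch. I, §6.3] -/
def dyadicBlock (L : ℕ) : Finset ℤ := (Finset.Ioo (-(2 * L : ℤ)) (2 * L)).filter fun m => (L : ℤ) ≤ |m|

/-- Membership in the dyadic block. [folklore] -/
theorem mem_dyadicBlock {L : ℕ} {m : ℤ} : m ∈ dyadicBlock L ↔ (L : ℤ) ≤ |m| ∧ |m| < 2 * L := by
  unfold dyadicBlock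
  rw [Finset.mem_filter, Finset.mem_Ioo, abs_lt]
  tauto

/-- The dyadic block has at most `2L` elements (in fact exactly, for `L ≥ 1`). [folklore] -/
theorem card_dyadicBlock_le (L : ℕ) : (dyadicBlock L).card ≤ 2 * L := by
  classical
  -- inject into `Ico L 2L ⊕ Ico L 2L` via `m ↦ |m|` and the sign
  have hsub : dyadicBlock L ⊆ (Finset.Ico (L : ℤ) (2 * L)) ∪ (Finset.Ico (L : ℤ) (2 * L)).image (fun m => -m) := by
    intro m hm
    rw [mem_dyadicBlock] at hm
    rcases le_or_gt 0 m with h0 | h0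
    · rw [abs_of_nonneg h0] at hm
      exact Finset.mem_union_left _ (Finset.mem_Ico.mpr hm)
    · rw [abs_of_neg h0] at hm
      refine Finset.mem_union_right _ (Finset.mem_image.mpr ⟨-m, Finset.mem_Ico.mpr ⟨hm.1, hm.2⟩, neg_neg m⟩)
  refine (Finset.card_le_card hsub).trans ((Finset.card_union_le _ _).trans ?_)
  have h1 : (Finset.Ico (L : ℤ) (2 * L)).card = L := by rw [Int.card_Ico]; omega
  have h2 : ((Finset.Ico (L : ℤ) (2 * L)).image (fun m => -m)).card ≤ L :=
    Finset.card_image_le.trans (le_of_eq h1)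
  omega

/-- **The dyadic block estimate** (6.4): `∑_{L ≤ |m| < 2L} |F̂(m)|² ≤ M²/(32 L²)` for an
`M`-Lipschitz `F`. [cite: Katznelson2004, Ch. I, §6.3, (6.4)] -/
theorem sum_dyadicBlock_sq_le (hF : ∀ x y, ‖F x - F y‖ ≤ M * dist x y) {L : ℕ} (hL : 1 ≤ L) :
    ∑ m ∈ dyadicBlock L, ‖fourierCoeff F m‖ ^ 2 ≤ M ^ 2 / (32 * L ^ 2) := by
  have hLpos : (0 : ℝ) < L := by exact_mod_cast hL
  have hS := hasSum_sq_fourierCoeff_translateSub F (dyadicStep L)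
  have hle : ∑ m ∈ dyadicBlock L, ‖fourier m (dyadicStep L) - 1‖ ^ 2 * ‖fourierCoeff F m‖ ^ 2 ≤
      (M * ‖dyadicStep L‖) ^ 2 :=
    (sum_le_hasSum (dyadicBlock L) (fun m _ => by positivity) hS).trans
      (integral_sq_translateSub_le F hF _)
  rw [norm_dyadicStep hL] at hle
  have h2 : 2 * ∑ m ∈ dyadicBlock L, ‖fourierCoeff F m‖ ^ 2 ≤
      ∑ m ∈ dyadicBlock L, ‖fourier m (dyadicStep L) - 1‖ ^ 2 * ‖fourierCoeff F m‖ ^ 2 := by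
    rw [Finset.mul_sum]
    refine Finset.sum_le_sum fun m hm => ?_
    have hm' := mem_dyadicBlock.mp hm
    exact mul_le_mul_of_nonneg_right (two_le_norm_fourier_dyadicStep_sub_one_sq hL hm'.1 hm'.2)
      (by positivity)
  have h3 : (M * (1 / (4 * L))) ^ 2 = M ^ 2 / (16 * L ^ 2) := by field_simp; ring
  rw [h3] at hle
  rw [le_div_iff₀ (by positivity)]
  rw [le_div_iff₀ (by positivity)] at hle
  nlinarith

/-- **Cauchy–Schwarz on the dyadic block** (6.5): `∑_{L ≤ |m| < 2L} |F̂(m)| ≤ M / (4 √L)`.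
[cite: Katznelson2004, Ch. I, §6.3, (6.5)] -/
theorem sum_dyadicBlock_le (hM : 0 ≤ M) (hF : ∀ x y, ‖F x - F y‖ ≤ M * dist x y) {L : ℕ} (hL : 1 ≤ L) :
    ∑ m ∈ dyadicBlock L, ‖fourierCoeff F m‖ ≤ M / (4 * Real.sqrt L) := by
  have hLpos : (0 : ℝ) < L := by exact_mod_cast hL
  have hsqrt : 0 < Real.sqrt L := Real.sqrt_pos.mpr hLpos
  have hCS := sq_sum_le_card_mul_sum_sq (s := dyadicBlock L) (f := fun m => ‖fourierCoeff F m‖)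
  have hcard : ((dyadicBlock L).card : ℝ) ≤ 2 * L := by exact_mod_cast card_dyadicBlock_le L
  have hblock := sum_dyadicBlock_sq_le F hF hL
  have hsq : (∑ m ∈ dyadicBlock L, ‖fourierCoeff F m‖) ^ 2 ≤ (M / (4 * Real.sqrt L)) ^ 2 := by
    calc (∑ m ∈ dyadicBlock L, ‖fourierCoeff F m‖) ^ 2
        ≤ (dyadicBlock L).card * ∑ m ∈ dyadicBlock L, ‖fourierCoeff F m‖ ^ 2 := hCS
      _ ≤ (2 * L) * (M ^ 2 / (32 * L ^ 2)) :=
          mul_le_mul hcard hblock (Finset.sum_nonneg fun m _ => by positivity) (by positivity)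
      _ = (M / (4 * Real.sqrt L)) ^ 2 := by
          rw [div_pow, mul_pow, Real.sq_sqrt hLpos.le]
          field_simp
          ring
  exact (pow_le_pow_iff_left₀ (Finset.sum_nonneg fun m _ => norm_nonneg _) (by positivity)
    two_ne_zero).mp hsq

end bernstein


section tail

variable (F : C(AddCircle (1 : ℝ), ℂ)) {M : ℝ}

/-- Sums of non-negative terms over a union. [folklore] -/
theorem sum_union_le_of_nonneg {ι : Type*} [DecidableEq ι] {s t : Finset ι} {f : ι → ℝ}
    (hf : ∀ i, 0 ≤ f i) : ∑ i ∈ s ∪ t, f i ≤ ∑ i ∈ s, f i + ∑ i ∈ t, f i := by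
  rw [← Finset.sum_union_inter]
  linarith [Finset.sum_nonneg fun i (_ : i ∈ s ∩ t) => hf i]

/-- The tail block `{m : K ≤ |m| < 4^J K}`. [cite: Katznelson2004, Ch. I, §6.3 (summing (6.5) over
the dyadic blocks)] -/
def quadTail (K J : ℕ) : Finset ℤ :=
  (Finset.Ioo (-(4 ^ J * K : ℤ)) (4 ^ J * K)).filter fun m => (K : ℤ) ≤ |m|

/-- Membership in the tail block. [folklore] -/
theorem mem_quadTail {K J : ℕ} {m : ℤ} : m ∈ quadTail K J ↔ (K : ℤ) ≤ |m| ∧ |m| < 4 ^ J * K := by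
  unfold quadTail
  rw [Finset.mem_filter, Finset.mem_Ioo, abs_lt]
  tauto

/-- The next tail block is the union of the previous one and two dyadic blocks. [folklore] -/
theorem quadTail_succ_subset (K J : ℕ) :
    quadTail K (J + 1) ⊆ quadTail K J ∪ (dyadicBlock (4 ^ J * K) ∪ dyadicBlock (2 * (4 ^ J * K))) := by
  intro m hm
  rw [mem_quadTail] at hm
  rw [Finset.mem_union, Finset.mem_union, mem_quadTail, mem_dyadicBlock, mem_dyadicBlock]
  push_cast at hm ⊢
  rw [pow_succ] at hm
  rcases lt_or_ge |m| (4 ^ J * K) with h1 | h1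
  · exact Or.inl ⟨hm.1, h1⟩
  · rcases lt_or_ge |m| (2 * (4 ^ J * K)) with h2 | h2
    · exact Or.inr (Or.inl ⟨h1, h2⟩)
    · exact Or.inr (Or.inr ⟨h2, by linarith [hm.2]⟩)

/-- A dyadic block contributes at most `M/(4√L)`, monotonically in `L`. [folklore] -/
theorem sum_dyadicBlock_le_of_le (hM : 0 ≤ M) (hF : ∀ x y, ‖F x - F y‖ ≤ M * dist x y) {L L₀ : ℕ}
    (hL₀ : 1 ≤ L₀) (hL : L₀ ≤ L) :
    ∑ m ∈ dyadicBlock L, ‖fourierCoeff F m‖ ≤ M / (4 * Real.sqrt L₀) := by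
  have hL1 : 1 ≤ L := hL₀.trans hL
  refine (sum_dyadicBlock_le F hM hF hL1).trans ?_
  have h0 : 0 < Real.sqrt L₀ := Real.sqrt_pos.mpr (by exact_mod_cast hL₀)
  have hcast : (L₀ : ℝ) ≤ L := by exact_mod_cast hL
  gcongr

/-- **The tail estimate**: `∑_{K ≤ |m| < 4^J K} |F̂(m)| ≤ (M/√K)(1 - 2^{-J}) ≤ M/√K` for `K ≥ 1`
(summing the dyadic block estimates). [cite: Katznelson2004, Ch. I, §6.3 ("we can sum the
inequalities (6.5) for `m = 0, 1, …`")] -/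
theorem sum_quadTail_le (hM : 0 ≤ M) (hF : ∀ x y, ‖F x - F y‖ ≤ M * dist x y) {K : ℕ} (hK : 1 ≤ K)
    (J : ℕ) : ∑ m ∈ quadTail K J, ‖fourierCoeff F m‖ ≤ M / Real.sqrt K * (1 - (1 / 2) ^ J) := by
  classical
  have hKpos : (0 : ℝ) < K := by exact_mod_cast hK
  have hsK : 0 < Real.sqrt K := Real.sqrt_pos.mpr hKpos
  induction J with
  | zero =>
    have h0 : quadTail K 0 = ∅ := by
      ext m
      simp only [mem_quadTail, pow_zero, one_mul, Finset.notMem_empty, iff_false, not_and, not_lt]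
      exact fun h => h
    rw [h0, Finset.sum_empty]
    simp
  | succ J ih =>
    have hpow : (1 : ℕ) ≤ 4 ^ J * K := Nat.one_le_iff_ne_zero.mpr (by positivity)
    -- the two new dyadic blocks contribute at most `M/(2 · 2^J √K)`
    have hsqrt : Real.sqrt ((4 ^ J * K : ℕ) : ℝ) = 2 ^ J * Real.sqrt K := by
      push_cast
      rw [show (4 : ℝ) ^ J = (2 ^ J) ^ 2 by rw [← pow_mul, mul_comm, pow_mul]; norm_num,
        Real.sqrt_mul (by positivity), Real.sqrt_sq (by positivity)]
    have hb1 := sum_dyadicBlock_le_of_le F hM hF hpow le_rfl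
    have hb2 := sum_dyadicBlock_le_of_le F hM hF hpow (Nat.le_mul_of_pos_left _ two_pos)
    rw [hsqrt] at hb1 hb2
    have hnn : ∀ i : ℤ, 0 ≤ ‖fourierCoeff F i‖ := fun i => norm_nonneg _
    calc ∑ m ∈ quadTail K (J + 1), ‖fourierCoeff F m‖
        ≤ ∑ m ∈ quadTail K J ∪ (dyadicBlock (4 ^ J * K) ∪ dyadicBlock (2 * (4 ^ J * K))),
            ‖fourierCoeff F m‖ :=
          Finset.sum_le_sum_of_subset_of_nonneg (quadTail_succ_subset K J) fun i _ _ => hnn i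
      _ ≤ ∑ m ∈ quadTail K J, ‖fourierCoeff F m‖ +
            (∑ m ∈ dyadicBlock (4 ^ J * K), ‖fourierCoeff F m‖ +
              ∑ m ∈ dyadicBlock (2 * (4 ^ J * K)), ‖fourierCoeff F m‖) :=
          (sum_union_le_of_nonneg hnn).trans (add_le_add le_rfl (sum_union_le_of_nonneg hnn))
      _ ≤ M / Real.sqrt K * (1 - (1 / 2) ^ J) +
            (M / (4 * (2 ^ J * Real.sqrt K)) + M / (4 * (2 ^ J * Real.sqrt K))) :=
          add_le_add ih (add_le_add hb1 hb2)
      _ = M / Real.sqrt K * (1 - (1 / 2) ^ (J + 1)) := by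
          simp only [one_div_pow]
          field_simp
          ring

/-- The tail block bound in the form used below: `∑_{K ≤ |m| < 4^J K} |F̂(m)| ≤ M/√K`. [folklore] -/
theorem sum_quadTail_le' (hM : 0 ≤ M) (hF : ∀ x y, ‖F x - F y‖ ≤ M * dist x y) {K : ℕ} (hK : 1 ≤ K)
    (J : ℕ) : ∑ m ∈ quadTail K J, ‖fourierCoeff F m‖ ≤ M / Real.sqrt K := by
  refine (sum_quadTail_le F hM hF hK J).trans ?_
  have h0 : 0 ≤ M / Real.sqrt K := div_nonneg hM (Real.sqrt_nonneg _)
  have h1 : (1 : ℝ) - (1 / 2) ^ J ≤ 1 := by linarith [pow_nonneg (by norm_num : (0 : ℝ) ≤ 1 / 2) J]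
  nlinarith

/-- Every finite set of integers of modulus `≥ K` lies in some tail block. [folklore] -/
theorem exists_subset_quadTail {K : ℕ} (hK : 1 ≤ K) (u : Finset ℤ) (hu : ∀ m ∈ u, (K : ℤ) ≤ |m|) :
    ∃ J : ℕ, u ⊆ quadTail K J := by
  classical
  obtain ⟨B, hB⟩ : ∃ B : ℕ, ∀ m ∈ u, |m| < B := by
    refine ⟨u.sup (fun m => |m|.toNat) + 1, fun m hm => ?_⟩
    have h1 : |m|.toNat ≤ u.sup (fun m => |m|.toNat) := Finset.le_sup (f := fun m => |m|.toNat) hm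
    have h2 : (|m| : ℤ) = (|m|.toNat : ℤ) := (Int.toNat_of_nonneg (abs_nonneg m)).symm
    omega
  refine ⟨B, fun m hm => mem_quadTail.mpr ⟨hu m hm, ?_⟩⟩
  have h1 : (B : ℤ) ≤ 4 ^ B := by exact_mod_cast (Nat.lt_pow_self (by norm_num : 1 < 4)).le
  have h2 : (4 : ℤ) ^ B ≤ 4 ^ B * K := le_mul_of_one_le_right (by positivity) (by exact_mod_cast hK)
  linarith [hB m hm]

/-- **Bernstein's theorem** (absolute summability): the Fourier coefficients of a Lipschitz
function on `ℝ/ℤ` are absolutely summable. [cite: Katznelson2004, Ch. I, §6.3, Theorem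
(Bernstein), the case `α = 1`] -/
theorem summable_norm_fourierCoeff (hM : 0 ≤ M) (hF : ∀ x y, ‖F x - F y‖ ≤ M * dist x y) :
    Summable fun m : ℤ => ‖fourierCoeff F m‖ := by
  classical
  refine summable_of_sum_le (fun m => norm_nonneg _) (c := ‖fourierCoeff F 0‖ + M) fun u => ?_
  -- split off `m = 0`
  have hsplit : ∑ m ∈ u, ‖fourierCoeff F m‖ ≤
      ‖fourierCoeff F 0‖ + ∑ m ∈ u.filter (fun m => m ≠ 0), ‖fourierCoeff F m‖ := by
    rw [← Finset.sum_filter_add_sum_filter_not u (fun m => m = 0)]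
    refine add_le_add ?_ (le_of_eq (Finset.sum_congr (by ext m; simp) fun _ _ => rfl))
    rcases Finset.eq_empty_or_nonempty (u.filter fun m => m = 0) with h | h
    · rw [h, Finset.sum_empty]; exact norm_nonneg _
    · have : u.filter (fun m => m = 0) = {0} := by
        ext m
        simp only [Finset.mem_filter, Finset.mem_singleton]
        constructor
        · exact fun h => h.2
        · intro hm
          subst hm
          obtain ⟨m', hm'⟩ := h
          have := (Finset.mem_filter.mp hm')
          rw [this.2] at this
          exact ⟨this.1, rfl⟩
      rw [this, Finset.sum_singleton]
  refine hsplit.trans (add_le_add le_rfl ?_)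
  obtain ⟨J, hJ⟩ := exists_subset_quadTail le_rfl (u.filter fun m => m ≠ 0) fun m hm => by
    have := (Finset.mem_filter.mp hm).2
    have : 0 < |m| := abs_pos.mpr this
    push_cast
    omega
  refine (Finset.sum_le_sum_of_subset_of_nonneg hJ fun i _ _ => norm_nonneg _).trans ?_
  have := sum_quadTail_le' F hM hF le_rfl J
  rwa [Nat.cast_one, Real.sqrt_one, div_one] at this

/-- **Uniform approximation of Lipschitz functions on `ℝ/ℤ` by trigonometric polynomials** (from
Bernstein's theorem): if `F : ℝ/ℤ → ℂ` is `M`-Lipschitz then for every `K ≥ 1` and every `x`,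
`|F(x) - ∑_{|m| < K} F̂(m) e_m(x)| ≤ M/√K`. (For `1`-bounded `F` one has in addition `|F̂(m)| ≤ 1`,
`norm_fourierCoeff_le_one`.) [cite: Katznelson2004, Ch. I, §6.3, Theorem (Bernstein) and (6.5)] -/
theorem norm_sub_trigPoly_le (hM : 0 ≤ M) (hF : ∀ x y, ‖F x - F y‖ ≤ M * dist x y)
    {K : ℕ} (hK : 1 ≤ K) (x : AddCircle (1 : ℝ)) :
    ‖F x - ∑ m ∈ Finset.Ioo (-(K : ℤ)) K, fourierCoeff F m * fourier m x‖ ≤ M / Real.sqrt K := by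
  classical
  have hsumm := summable_norm_fourierCoeff F hM hF
  have hS := has_pointwise_sum_fourier_series_of_summable (Summable.of_norm hsumm) x
  set s : Finset ℤ := Finset.Ioo (-(K : ℤ)) K with hs
  -- the Fourier series minus its partial sum over `s`
  have hcompl : HasSum (fun i : {i // i ∉ s} => fourierCoeff F i • fourier (i : ℤ) x)
      (F x - ∑ m ∈ s, fourierCoeff F m * fourier m x) := by
    refine (Finset.hasSum_compl_iff (f := fun i : ℤ => fourierCoeff F i • fourier i x) s).mpr ?_
    simp only [smul_eq_mul] at hS ⊢
    rwa [sub_add_cancel]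
  -- the majorant
  have hg : HasSum (fun i : {i // i ∉ s} => ‖fourierCoeff F i‖) (∑' i : {i // i ∉ s}, ‖fourierCoeff F i‖) :=
    (hsumm.subtype _).hasSum
  refine (HasSum.norm_le_of_bounded hcompl hg fun i => ?_).trans ?_
  · rw [norm_smul, fourier_apply, Circle.norm_coe, mul_one]
  · refine (hsumm.subtype _).tsum_le_of_sum_le fun u => ?_
    -- `u` is a finite set of indices `i ∉ s`, i.e. `|i| ≥ K`
    have hu : ∀ m ∈ u.map (Function.Embedding.subtype _), (K : ℤ) ≤ |m| := by
      intro m hm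
      obtain ⟨i, _, rfl⟩ := Finset.mem_map.mp hm
      have hi : (i : ℤ) ∉ Finset.Ioo (-(K : ℤ)) K := i.2
      show (K : ℤ) ≤ |(i : ℤ)|
      rw [Finset.mem_Ioo, not_and_or, not_lt, not_lt] at hi
      rcases hi with h | h
      · rw [abs_of_nonpos (by linarith)]; linarith
      · rw [abs_of_nonneg (by linarith)]; linarith
    obtain ⟨J, hJ⟩ := exists_subset_quadTail hK _ hu
    have hmap : ∑ i ∈ u, ‖fourierCoeff F (i : ℤ)‖ =
        ∑ m ∈ u.map (Function.Embedding.subtype _), ‖fourierCoeff F m‖ := by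
      rw [Finset.sum_map]; rfl
    show ∑ i ∈ u, ‖fourierCoeff F (i : ℤ)‖ ≤ _
    rw [hmap]
    exact (Finset.sum_le_sum_of_subset_of_nonneg hJ fun i _ _ => norm_nonneg _).trans
      (sum_quadTail_le' F hM hF hK J)

end tail

end Literature.Analysis.Fourier
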